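import Literature.NumberTheory.LFunctions.UniformClassGroupPNTChebyshev
import HarnessLib

/-!
# Signed partial summation: from a one-sided bound for `Σ_C w_C θ_C(t)` to `Σ_C w_C π_C(x)`

Topic `Summits/QuantumAdvantage/QuantumAdvantage/Theorems`, helper for the stub
`stub_perCharacterDeficit_of_density` (line `subgroup-orthogonality-escape`, crux
`DegreeOnePrimesEscape`, stmt-QuantumAdvantage-11543).

Partial summation is LINEAR, hence valid for signed weights `w_C` (`|w_C| ≤ 1`, e.g.
`w_C = Re χ(C)`) on the ideal classes of a number field `K`:

* `sum_mul_primeIdealClassCount_eq` — `Σ_C w_C π_C(x) = T(x)/log x + ∫₂ˣ T(t) dt/(t log² t)` with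
  `T(t) = Σ_C w_C θ_C(t)` (`x ≥ 2`; the tree's `primeIdealClassCount_eq_theta_div_log_add_integral`
  class by class);
* `sum_mul_primeIdealClassCount_le` — if `T(t) ≤ η t` on `[Y, x]` and `θ_K(t) ≤ B t` on `[2, Y]`
  (`|T| ≤ θ_K` always), then `Σ_C w_C π_C(x) ≤ η Li(x) + 3η + 3 B Y`
  (`∫₂ˣ dt/log² t = Li(x) − x/log x + 2/log 2`, `offsetLogIntegral_eq_div_log_add_integral`).
-/

noncomputable section

open Real MeasureTheory Set Finset
open scoped NumberField nonZeroDivisors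
open Literature.NumberTheory.LFunctions Literature.NumberTheory.LFunctions.NumberField

namespace Summit.QuantumAdvantage.QuantumAdvantage.Theorems.DegreeOnePrimesEscape

variable {K : Type} [Field K] [NumberField K]

/-- **Signed partial summation identity**: for weights `w` on `Cl_K` and `x ≥ 2`,
`Σ_C w_C π_C(x) = (Σ_C w_C θ_C(x))/log x + ∫₂ˣ (Σ_C w_C θ_C(t)) dt/(t log² t)`. -/
theorem sum_mul_primeIdealClassCount_eq (w : ClassGroup (𝓞 K) → ℝ) {x : ℝ} (hx : 2 ≤ x) :
    ∑ C, w C * (primeIdealClassCount K C x : ℝ) =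
      (∑ C, w C * chebyshevThetaIdealClass K C x) / Real.log x +
        ∫ t in (2:ℝ)..x, (∑ C, w C * chebyshevThetaIdealClass K C t) / (t * Real.log t ^ 2) := by
  have hint : ∀ C : ClassGroup (𝓞 K), IntervalIntegrable
      (fun t ↦ w C * (chebyshevThetaIdealClass K C t / (t * Real.log t ^ 2))) volume 2 x := by
    intro C
    rw [intervalIntegrable_iff_integrableOn_Icc_of_le hx]
    exact (integrableOn_chebyshevThetaIdealClass_div K C x).const_mul (w C)
  have hfun : (fun t ↦ (∑ C, w C * chebyshevThetaIdealClass K C t) / (t * Real.log t ^ 2)) =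
      fun t ↦ ∑ C, w C * (chebyshevThetaIdealClass K C t / (t * Real.log t ^ 2)) := by
    funext t; rw [Finset.sum_div]; simp_rw [mul_div_assoc]
  rw [hfun, intervalIntegral.integral_finsetSum (fun C _ ↦ hint C), Finset.sum_div,
    ← Finset.sum_add_distrib]
  refine Finset.sum_congr rfl fun C _ ↦ ?_
  rw [intervalIntegral.integral_const_mul, primeIdealClassCount_eq_theta_div_log_add_integral K C hx]
  ring

/-- `|Σ_C w_C θ_C(t)| ≤ θ_K(t)` for `|w_C| ≤ 1`. -/
theorem abs_sum_mul_chebyshevThetaIdealClass_le (w : ClassGroup (𝓞 K) → ℝ) (hw : ∀ C, |w C| ≤ 1)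
    (t : ℝ) : |∑ C, w C * chebyshevThetaIdealClass K C t| ≤ chebyshevThetaIdeal K t := by
  refine (Finset.abs_sum_le_sum_abs _ _).trans ?_
  rw [← sum_chebyshevThetaIdealClass K t]
  refine Finset.sum_le_sum fun C _ ↦ ?_
  have h0 := chebyshevThetaIdealClass_nonneg (K := K) C t
  rw [abs_mul, abs_of_nonneg h0]
  calc |w C| * chebyshevThetaIdealClass K C t ≤ 1 * chebyshevThetaIdealClass K C t :=
        mul_le_mul_of_nonneg_right (hw C) h0
    _ = _ := one_mul _

/-- `2/log 2 ≤ 3` and `1/log² 2 ≤ 3`. -/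
theorem log_two_consts : 2 / Real.log 2 ≤ 3 ∧ 1 / Real.log 2 ^ 2 ≤ 3 := by
  have h := Real.log_two_gt_d9
  have hpos : 0 < Real.log 2 := by linarith
  constructor
  · rw [div_le_iff₀ hpos]; linarith
  · rw [div_le_iff₀ (by positivity)]; nlinarith

/-- **One-sided bound for the signed count by partial summation.** For weights `|w_C| ≤ 1`,
`2 ≤ Y ≤ x`, `η, B ≥ 0`: if `Σ_C w_C θ_C(t) ≤ η t` for `t ∈ [Y, x]` and `θ_K(t) ≤ B t` for
`t ∈ [2, Y]`, then `Σ_C w_C π_C(x) ≤ η Li(x) + 3η + 3 B Y`. -/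
theorem sum_mul_primeIdealClassCount_le (w : ClassGroup (𝓞 K) → ℝ) (hw : ∀ C, |w C| ≤ 1)
    {η B Y x : ℝ} (hY : 2 ≤ Y) (hYx : Y ≤ x) (hη : 0 ≤ η) (hB : 0 ≤ B)
    (hup : ∀ t ∈ Set.Icc Y x, ∑ C, w C * chebyshevThetaIdealClass K C t ≤ η * t)
    (hBt : ∀ t ∈ Set.Icc 2 Y, chebyshevThetaIdeal K t ≤ B * t) :
    ∑ C, w C * (primeIdealClassCount K C x : ℝ) ≤ η * offsetLogIntegral x + 3 * η + 3 * B * Y := by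
  have hx2 : 2 ≤ x := hY.trans hYx
  have hlogx : 0 < Real.log x := Real.log_pos (by linarith)
  obtain ⟨hl2, hl22⟩ := log_two_consts
  have hl2pos : 0 < Real.log 2 := Real.log_pos (by norm_num)
  rw [sum_mul_primeIdealClassCount_eq w hx2]
  -- the integrand and its integrability
  have hF : ∀ {a b : ℝ}, 2 ≤ a → a ≤ b → b ≤ x → IntervalIntegrable
      (fun t ↦ (∑ C, w C * chebyshevThetaIdealClass K C t) / (t * Real.log t ^ 2)) volume a b := by
    intro a b ha hab hb
    have hfun : (fun t ↦ (∑ C, w C * chebyshevThetaIdealClass K C t) / (t * Real.log t ^ 2)) =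
        fun t ↦ ∑ C, w C * (chebyshevThetaIdealClass K C t / (t * Real.log t ^ 2)) := by
      funext t; rw [Finset.sum_div]; simp_rw [mul_div_assoc]
    have hI : IntegrableOn (fun t ↦ ∑ C, w C * (chebyshevThetaIdealClass K C t / (t * Real.log t ^ 2)))
        (Set.Icc 2 x) volume :=
      integrable_finsetSum _ fun C _ ↦ (integrableOn_chebyshevThetaIdealClass_div K C x).const_mul (w C)
    rw [hfun, intervalIntegrable_iff_integrableOn_Icc_of_le hab]
    exact hI.mono_set (Set.Icc_subset_Icc ha hb)
  -- pointwise bounds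
  have hpt1 : ∀ t ∈ Set.Icc 2 Y,
      (∑ C, w C * chebyshevThetaIdealClass K C t) / (t * Real.log t ^ 2) ≤ 3 * B := by
    intro t ht
    have ht2 : 2 ≤ t := ht.1
    have hlogt : Real.log 2 ≤ Real.log t := Real.log_le_log (by norm_num) ht2
    have hlt0 : 0 < Real.log t := by linarith
    have hden : 0 < t * Real.log t ^ 2 := by positivity
    have h1 := (le_abs_self _).trans (abs_sum_mul_chebyshevThetaIdealClass_le w hw t)
    have h2 := hBt t ht
    rw [div_le_iff₀ hden]
    have h3 : B * t ≤ 3 * B * (t * Real.log t ^ 2) := by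
      have : 1 ≤ 3 * Real.log t ^ 2 := by
        have h22 : Real.log 2 ^ 2 ≤ Real.log t ^ 2 := pow_le_pow_left₀ hl2pos.le hlogt 2
        have : 1 ≤ 3 * Real.log 2 ^ 2 := by
          rw [div_le_iff₀ (by positivity)] at hl22; linarith
        linarith
      have ht0 : 0 ≤ B * t := by positivity
      nlinarith
    linarith
  have hpt2 : ∀ t ∈ Set.Icc Y x,
      (∑ C, w C * chebyshevThetaIdealClass K C t) / (t * Real.log t ^ 2) ≤ η * (1 / Real.log t ^ 2) := by
    intro t ht
    have ht2 : 2 ≤ t := hY.trans ht.1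
    have hlt0 : 0 < Real.log t := Real.log_pos (by linarith)
    have ht0 : 0 < t := by linarith
    have h := hup t ht
    calc (∑ C, w C * chebyshevThetaIdealClass K C t) / (t * Real.log t ^ 2)
        ≤ (η * t) / (t * Real.log t ^ 2) := div_le_div_of_nonneg_right h (by positivity)
      _ = η * (1 / Real.log t ^ 2) := by field_simp
  -- the two integrals
  have hI1 : ∫ t in (2:ℝ)..Y, (∑ C, w C * chebyshevThetaIdealClass K C t) / (t * Real.log t ^ 2) ≤
      3 * B * Y := by
    calc ∫ t in (2:ℝ)..Y, (∑ C, w C * chebyshevThetaIdealClass K C t) / (t * Real.log t ^ 2)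
        ≤ ∫ _ in (2:ℝ)..Y, 3 * B := by
          refine intervalIntegral.integral_mono_on hY (hF le_rfl hY hYx) (by simp) fun t ht ↦ hpt1 t ht
      _ = (Y - 2) * (3 * B) := by rw [intervalIntegral.integral_const, smul_eq_mul]
      _ ≤ 3 * B * Y := by nlinarith
  have hI2 : ∫ t in Y..x, (∑ C, w C * chebyshevThetaIdealClass K C t) / (t * Real.log t ^ 2) ≤
      η * (offsetLogIntegral x - x / Real.log x + 2 / Real.log 2) := by
    have hone : ∀ {a b : ℝ}, 2 ≤ a → 2 ≤ b → IntervalIntegrable (fun t ↦ 1 / Real.log t ^ 2) volume a b :=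
      fun ha hb ↦ Chebyshev.intervalIntegrable_one_div_log_sq (by linarith) (by linarith)
    have hLi : ∫ t in (2:ℝ)..x, 1 / Real.log t ^ 2 = offsetLogIntegral x - x / Real.log x + 2 / Real.log 2 := by
      have := offsetLogIntegral_eq_div_log_add_integral hx2; linarith
    have hsplit := intervalIntegral.integral_add_adjacent_intervals (hone le_rfl hY) (hone hY hx2)
    have hnn : 0 ≤ ∫ t in (2:ℝ)..Y, 1 / Real.log t ^ 2 :=
      intervalIntegral.integral_nonneg hY fun t _ ↦ by positivity
    calc ∫ t in Y..x, (∑ C, w C * chebyshevThetaIdealClass K C t) / (t * Real.log t ^ 2)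
        ≤ ∫ t in Y..x, η * (1 / Real.log t ^ 2) :=
          intervalIntegral.integral_mono_on hYx (hF hY hYx le_rfl) ((hone hY hx2).const_mul η)
            fun t ht ↦ hpt2 t ht
      _ = η * ∫ t in Y..x, 1 / Real.log t ^ 2 := intervalIntegral.integral_const_mul _ _
      _ ≤ η * ∫ t in (2:ℝ)..x, 1 / Real.log t ^ 2 :=
          mul_le_mul_of_nonneg_left (by linarith) hη
      _ = _ := by rw [hLi]
  have hsplitF := intervalIntegral.integral_add_adjacent_intervals (hF le_rfl hY hYx) (hF hY hYx le_rfl)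
  -- the boundary term
  have hbd : (∑ C, w C * chebyshevThetaIdealClass K C x) / Real.log x ≤ η * (x / Real.log x) := by
    have h := hup x ⟨hYx, le_rfl⟩
    calc (∑ C, w C * chebyshevThetaIdealClass K C x) / Real.log x ≤ (η * x) / Real.log x :=
          div_le_div_of_nonneg_right h hlogx.le
      _ = η * (x / Real.log x) := by ring
  rw [← hsplitF]
  have hη3 : η * (2 / Real.log 2) ≤ 3 * η := by nlinarith
  nlinarith [hbd, hI1, hI2, hη3]

/-- Closed form of `sum_mul_primeIdealClassCount_le`: the registered sub-goal of the stub `stub_perCharacterDeficit_of_density`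
proved by this file. -/
theorem perCharacterDeficit_partialSummation : ∀ {K : Type} [Field K] [NumberField K] (w : ClassGroup (𝓞 K) → ℝ) (hw : ∀ C, |w C| ≤ 1)
    {η B Y x : ℝ} (hY : 2 ≤ Y) (hYx : Y ≤ x) (hη : 0 ≤ η) (hB : 0 ≤ B)
    (hup : ∀ t ∈ Set.Icc Y x, ∑ C, w C * chebyshevThetaIdealClass K C t ≤ η * t)
    (hBt : ∀ t ∈ Set.Icc 2 Y, chebyshevThetaIdeal K t ≤ B * t),
    ∑ C, w C * (primeIdealClassCount K C x : ℝ) ≤ η * offsetLogIntegral x + 3 * η + 3 * B * Y :=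
  @sum_mul_primeIdealClassCount_le

end Summit.QuantumAdvantage.QuantumAdvantage.Theorems.DegreeOnePrimesEscape

end
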